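import Literature.Analysis.FluidPDE.FluidComputer.ThresholdLevelTableW
import HarnessLib

/-!
# Kernel run of the level-table checker over the gate-data box, chunks 24 … 27 (bp3 gen 13, layer 4: robustness variant)

HONEST FRAMING: low prior, high value-of-information experiment on Tao's machine paradigm; NOT a
claim that NS blows up.

Four kernel evaluations (`decide +kernel`; no `native_decide`, no extra axioms) of `runSteps`
with the interval gate data `GIw` (all couplings within relative `10⁻³`, `δ ∈ [0, 1.001 δ₀]`),
25 steps each, from `Bw24` to `Bw28`.
-/

namespace Literature.Analysis.FluidPDE.FluidComputer

namespace ThresholdLevelTable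

set_option maxHeartbeats 10000000 in
set_option maxRecDepth 200000 in
/-- Chunk 24 of the data-box table run (steps 600 … 624). [folklore] -/
theorem runW24 : runSteps 60 12 3 GIw RbIt Bw24 chunk24 36555230506079184 = some Bw25 := by
  decide +kernel

set_option maxHeartbeats 10000000 in
set_option maxRecDepth 200000 in
/-- Chunk 25 of the data-box table run (steps 625 … 649). [folklore] -/
theorem runW25 : runSteps 60 12 3 GIw RbIt Bw25 chunk25 43506710244646736 = some Bw26 := by
  decide +kernel

set_option maxHeartbeats 10000000 in
set_option maxRecDepth 200000 in
/-- Chunk 26 of the data-box table run (steps 650 … 674). [folklore] -/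
theorem runW26 : runSteps 60 12 3 GIw RbIt Bw26 chunk26 51780109442802328 = some Bw27 := by
  decide +kernel

set_option maxHeartbeats 10000000 in
set_option maxRecDepth 200000 in
/-- Chunk 27 of the data-box table run (steps 675 … 699). [folklore] -/
theorem runW27 : runSteps 60 12 3 GIw RbIt Bw27 chunk27 61626809263026112 = some Bw28 := by
  decide +kernel

end ThresholdLevelTable

end Literature.Analysis.FluidPDE.FluidComputer
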